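import Mathlib
import Summits.QuantumFields.YangMills.Theses.EquipartitionCriticality
import Summits.QuantumFields.YangMills.Theorems.EquipartitionCriticalityRPProbeCriticalityLogConvex
import Summits.QuantumFields.YangMills.Theorems.EquipartitionCriticalityRPProbeCriticalityTorusHankel
import Summits.QuantumFields.YangMills.Theorems.EquipartitionCriticalityRPProbeCriticalityOddLimit
import HarnessLib

/-!
# `EquipartitionCriticality.RPProbeCriticality` (stmt-QuantumFields-8763)

The support item `RPProbeCriticality` ("device B") of route `EquipartitionCriticality` of
`YangMills`: for every compact simple `G` and faithful unitary lattice representation `r`, the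
probe limit of `EquipartitionPinsProbe` — a bounded continuous `φ` and `g : ℕ → ℝ` with the
sub-exponential-decay condition (for every `m > 0` some `s < t` with `0 < g(2s)` and
`g(2s) e^{-m(2t-2s)} < g(2t)`) such that the covariances of the rescaled plaquette probe
`φ(β(N − Re tr r(U_p)))` at time separation `n` converge to `g(n)` as `β → ∞`, uniformly over the
torus-limit states `μ ∈ infiniteVolumeLimitPoints r.ρ β` — forces every admissible clustering
rate to tend to zero: if `m(β) > 0` and constants `C(A,B,β)` give
`|corr_(β,2S+1)(A,B,n)| ≤ C e^{−m(β)n}` for all species `A, B`, `S ≥ S₀(β)`, `n ≤ S`, then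
`m(β) < m₀` eventually, for every `m₀ > 0`.

## Proof (Osterwalder–Seiler 1978 §2; Glimm–Jaffe 1987 §6.1; Seiler LNP 159 Ch. 2)

Suppose `m(β) ≥ m₀` frequently as `β → ∞`; pick `s < t` from the `g`-condition at `m₀` and then a
large such `β ≥ max(β₁, 0)` at which the probe covariances of every torus-limit state are within
`ε = δ/3` of `g(2s)`, `g(2t)` (`δ = g(2t) − g(2s)e^{−m₀(2t−2s)} > 0`). At this `β`:
1. (compactness, `RPProbe.exists_oddTorusLimit`) some torus-limit state `μ` is a limit along ODD
   tori `2S_k+1`, and the torus connected correlations of the probe species converge to the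
   covariances `c(n)` under `μ` (`RPProbe.tendsto_latticeConnectedCorr_probe`);
2. (reflection positivity, `RPProbe.torus_hankel_nonneg`) on each odd torus the probe two-point
   function is `2 × 2`-Hankel positive, hence so is `n ↦ c(2n)` in the limit, and the clustering
   hypothesis passes to the limit: `|c(n)| ≤ C e^{−m(β)n}` for all `n`;
3. (log-convexity, `RPProbe.logConvex_contraction_iter`) `c(2t) ≤ e^{−2m(β)(t−s)} c(2s)
   ≤ e^{−m₀(2t−2s)} c(2s)` with `c(2s) ≥ 0`;
4. `g(2t) − ε < c(2t) ≤ e^{−m₀(2t−2s)}(g(2s) + ε) ≤ g(2s)e^{−m₀(2t−2s)} + ε`, i.e. `δ < 2ε`,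
   a contradiction.

Helper files (landed `--supports stmt-QuantumFields-8763`):
`EquipartitionCriticalityRPProbeCriticalityLogConvex` (step 3),
`EquipartitionCriticalityRPProbeCriticalityTorusHankel` (step 2, torus side),
`EquipartitionCriticalityRPProbeCriticalityOddLimit` (step 1).
-/

noncomputable section

namespace Summit.QuantumFields.YangMills.Theorems

open MeasureTheory Filter Topology
open Literature.MathematicalPhysics.QuantumFieldTheory Literature.MathematicalPhysics.QuantumLattice
open Summit.QuantumFields.YangMills.Theses.EquipartitionCriticality
open Summit.QuantumFields.YangMills.Theorems.EquipartitionCriticality.RPProbe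

/-- **`EquipartitionCriticality.RPProbeCriticality` holds** (item stmt-QuantumFields-8763, device
B of the card `equipartition-pins-free-gluon-law`): the probe limit of `EquipartitionPinsProbe`
implies that every admissible volume-uniform clustering rate `m(β)` of 4-D lattice Yang–Mills
with compact simple gauge group tends to `0` as `β → ∞` (reflection positivity makes the probe
time-covariances of an odd-torus limit state Hankel-positive, hence log-convex, and a rate bounded
below would contract the `β → ∞` limit `g` exponentially, contradicting its sub-exponential
decay; Osterwalder–Seiler 1978 §2, Glimm–Jaffe 1987 §6.1, Seiler LNP 159 Ch. 2). -/
theorem rpProbeCriticality_proof : RPProbeCriticality := by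
  intro G _ _ _ _ _hG r hprobe β₁ m hclust m₀ hm₀
  letI : MeasurableSpace G := borel G
  haveI : BorelSpace G := ⟨rfl⟩
  haveI : T2Space G := (r.continuous.isClosedEmbedding r.injective).isEmbedding.t2Space
  haveI : SecondCountableTopology G :=
    (r.continuous.isClosedEmbedding r.injective).isEmbedding.secondCountableTopology
  obtain ⟨φ, hφc, ⟨Cφ, hCφ⟩, g, hg, hlimit⟩ := hprobe
  by_contra hcon
  have hfreq : ∃ᶠ β : ℝ in atTop, m₀ ≤ m β :=
    (Filter.not_eventually.1 hcon).mono fun β h => not_lt.1 h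
  -- the witnesses of sub-exponential decay of `g` at rate `m₀`
  obtain ⟨s, t, hst, hgs, hgap⟩ := hg m₀ hm₀
  set E : ℝ := Real.exp (-(m₀ * (2 * (t : ℝ) - 2 * (s : ℝ)))) with hE
  have hEpos : 0 < E := Real.exp_pos _
  have hE1 : E ≤ 1 := by
    rw [hE, Real.exp_le_one_iff, neg_nonpos]
    have : (s : ℝ) ≤ t := by exact_mod_cast hst.le
    nlinarith
  set δ : ℝ := g (2 * t) - g (2 * s) * E with hδ
  have hδpos : 0 < δ := sub_pos.2 hgap
  set ε : ℝ := δ / 3 with hε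
  have hεpos : 0 < ε := by positivity
  -- a large `β` with `m β ≥ m₀` at which the probe covariances are `ε`-close to `g`
  have hev : ∀ᶠ β : ℝ in atTop,
      ((∀ μ ∈ infiniteVolumeLimitPoints (d := 4) r.ρ β,
          |(∫ U, φ (β * ((r.N : ℝ) - plaquetteObs r.ρ 0 1 2 U)) *
              φ (β * ((r.N : ℝ) - plaquetteObs r.ρ 0 1 2
                (configShift (-(Pi.single 0 ((2 * s : ℕ) : ℤ))) U))) ∂μ) -
            (∫ U, φ (β * ((r.N : ℝ) - plaquetteObs r.ρ 0 1 2 U)) ∂μ) *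
              (∫ U, φ (β * ((r.N : ℝ) - plaquetteObs r.ρ 0 1 2
                (configShift (-(Pi.single 0 ((2 * s : ℕ) : ℤ))) U))) ∂μ) - g (2 * s)| < ε) ∧
        (∀ μ ∈ infiniteVolumeLimitPoints (d := 4) r.ρ β,
          |(∫ U, φ (β * ((r.N : ℝ) - plaquetteObs r.ρ 0 1 2 U)) *
              φ (β * ((r.N : ℝ) - plaquetteObs r.ρ 0 1 2
                (configShift (-(Pi.single 0 ((2 * t : ℕ) : ℤ))) U))) ∂μ) -
            (∫ U, φ (β * ((r.N : ℝ) - plaquetteObs r.ρ 0 1 2 U)) ∂μ) *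
              (∫ U, φ (β * ((r.N : ℝ) - plaquetteObs r.ρ 0 1 2
                (configShift (-(Pi.single 0 ((2 * t : ℕ) : ℤ))) U))) ∂μ) - g (2 * t)| < ε)) ∧
        (β₁ ≤ β ∧ (0 : ℝ) ≤ β) :=
    ((hlimit (2 * s) ε hεpos).and (hlimit (2 * t) ε hεpos)).and
      ((eventually_ge_atTop β₁).and (eventually_ge_atTop 0))
  obtain ⟨β, hmβ, ⟨hclose_s, hclose_t⟩, hβ₁, hβ0⟩ := (hfreq.and_eventually hev).exists
  obtain ⟨hmpos, S₀, hclβ⟩ := hclust β hβ₁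
  -- the probe at this `β`, as a function on `G` and as a species
  set ψ : G → ℝ := fun x => φ (β * ((r.N : ℝ) - (r.ρ x).trace.re)) with hψ
  have hψc : Continuous ψ :=
    hφc.comp (continuous_const.mul (continuous_const.sub (continuous_trace_re r.ρ r.continuous)))
  have hψb : ∃ C : ℝ, ∀ x, |ψ x| ≤ C := ⟨Cφ, fun x => hCφ _⟩
  let A : YMSpecies G :=
    { F := fun U => φ (β * ((r.N : ℝ) - plaquetteObs r.ρ 0 1 2 U))
      supp := originPlaquetteSupport 1 2
      isCylinder := isCylinder_probe ψ
      gaugeInvariant := fun gt U => by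
        show φ (β * ((r.N : ℝ) - plaquetteObs r.ρ 0 1 2 (gaugeTransformZd gt U))) =
          φ (β * ((r.N : ℝ) - plaquetteObs r.ρ 0 1 2 U))
        rw [isZdGaugeInvariant_plaquetteObs]
      bounded := ⟨Cφ, fun U => hCφ _⟩
      measurable := (continuous_probe hψc).measurable }
  obtain ⟨C, hC⟩ := hclβ A A
  -- step 1: an odd-torus limit state and the convergence of the probe correlations
  obtain ⟨μ, hμp, sq, hsq, hconv, hμmem⟩ := exists_oddTorusLimit (d := 4) r.ρ r.continuous β
  haveI := hμp
  set c : ℕ → ℝ := fun n =>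
    (∫ U, φ (β * ((r.N : ℝ) - plaquetteObs r.ρ 0 1 2 U)) *
        φ (β * ((r.N : ℝ) - plaquetteObs r.ρ 0 1 2
          (configShift (-(Pi.single 0 (n : ℤ))) U))) ∂μ) -
      (∫ U, φ (β * ((r.N : ℝ) - plaquetteObs r.ρ 0 1 2 U)) ∂μ) *
        (∫ U, φ (β * ((r.N : ℝ) - plaquetteObs r.ρ 0 1 2
          (configShift (-(Pi.single 0 (n : ℤ))) U))) ∂μ) with hc
  have hlim : ∀ n : ℕ, Tendsto (fun k : ℕ => latticeConnectedCorr r.ρ β (2 * sq k + 1) A.F A.F n)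
      atTop (𝓝 (c n)) := fun n =>
    tendsto_latticeConnectedCorr_probe r.ρ β hψc hψb hconv n
  -- step 2a: clustering passes to the limit
  have hbd : ∀ n : ℕ, |c n| ≤ C * Real.exp (-(m β * n)) := by
    intro n
    refine le_of_tendsto (hlim n).abs ?_
    filter_upwards [(hsq.tendsto_atTop).eventually_ge_atTop (max S₀ n)] with k hk
    exact hC (sq k) n (le_of_max_le_left hk) (le_of_max_le_right hk)
  -- step 2b: Hankel positivity passes to the limit
  have hpsd : ∀ (n : ℕ) (x y : ℝ),
      0 ≤ x ^ 2 * c (2 * n) + 2 * x * y * c (2 * (n + 1)) + y ^ 2 * c (2 * (n + 2)) := by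
    intro n x y
    have hl : Tendsto (fun k : ℕ =>
        x ^ 2 * latticeConnectedCorr r.ρ β (2 * sq k + 1) A.F A.F (2 * n) +
          2 * x * y * latticeConnectedCorr r.ρ β (2 * sq k + 1) A.F A.F (2 * (n + 1)) +
          y ^ 2 * latticeConnectedCorr r.ρ β (2 * sq k + 1) A.F A.F (2 * (n + 2)))
        atTop (𝓝 (x ^ 2 * c (2 * n) + 2 * x * y * c (2 * (n + 1)) + y ^ 2 * c (2 * (n + 2)))) :=
      ((tendsto_const_nhds.mul (hlim _)).add (tendsto_const_nhds.mul (hlim _))).add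
        (tendsto_const_nhds.mul (hlim _))
    refine ge_of_tendsto hl ?_
    filter_upwards [(hsq.tendsto_atTop).eventually_ge_atTop (n + 2)] with k hk
    have h := torus_hankel_nonneg r.ρ r.continuous hβ0 hψc hψb (S := sq k) (by omega)
      (i := n) (j := n + 2) (by omega) hk x y
    rw [← latticeConnectedCorr_probe r.ρ β ψ (sq k) (2 * n),
      ← latticeConnectedCorr_probe r.ρ β ψ (sq k) (n + (n + 2)),
      ← latticeConnectedCorr_probe r.ρ β ψ (sq k) (2 * (n + 2))] at h
    have e : n + (n + 2) = 2 * (n + 1) := by ring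
    rw [e] at h
    exact h
  -- step 3: log-convex contraction between `2s` and `2t`
  have hnn : 0 ≤ c (2 * s) := nonneg_of_quadForm_nonneg (a := fun n => c (2 * n)) hpsd s
  have hbd2 : ∀ n : ℕ, c (2 * n) ≤ C * Real.exp (-(2 * m β * n)) := fun n => by
    have h := (le_abs_self _).trans (hbd (2 * n))
    have e : -(m β * ((2 * n : ℕ) : ℝ)) = -(2 * m β * (n : ℝ)) := by push_cast; ring
    rwa [e] at h
  have hcontr := logConvex_contraction_iter (a := fun n => c (2 * n)) (m := 2 * m β) hpsd hbd2
    s (t - s)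
  have est : s + (t - s) = t := by omega
  simp only [est] at hcontr
  -- hcontr : c (2 * t) ≤ exp (-(2 m β (t - s))) * c (2 * s)
  have hexp_le : Real.exp (-(2 * m β * ((t - s : ℕ) : ℝ))) ≤ E := by
    rw [hE, Real.exp_le_exp, Nat.cast_sub hst.le]
    have : (s : ℝ) ≤ t := by exact_mod_cast hst.le
    nlinarith
  have h3 : c (2 * t) ≤ E * c (2 * s) :=
    hcontr.trans (mul_le_mul_of_nonneg_right hexp_le hnn)
  -- step 4: comparison with `g`
  have hs' : |c (2 * s) - g (2 * s)| < ε := hclose_s μ hμmem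
  have ht' : |c (2 * t) - g (2 * t)| < ε := hclose_t μ hμmem
  have hs1 : c (2 * s) < g (2 * s) + ε := by linarith [(abs_lt.1 hs').2]
  have ht1 : g (2 * t) - ε < c (2 * t) := by linarith [(abs_lt.1 ht').1]
  have h4 : E * c (2 * s) ≤ E * g (2 * s) + ε := by
    have h5 : E * c (2 * s) ≤ E * (g (2 * s) + ε) := mul_le_mul_of_nonneg_left hs1.le hEpos.le
    have h6 : E * ε ≤ ε := mul_le_of_le_one_left hεpos.le hE1
    linarith
  have h7 : g (2 * t) - ε < E * g (2 * s) + ε := by linarith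
  have h8 : δ = g (2 * t) - g (2 * s) * E := rfl
  have h9 : ε = δ / 3 := rfl
  nlinarith [h7, h8, h9, hδpos]

end Summit.QuantumFields.YangMills.Theorems

end
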